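import Mathlib

/-!
# KPlusLogSqLaw — the two-speed parity law FAILS for speeds `{±1, ±3}` (kernel-checked instance, `N = 9`)

Context (route `KPlusLogSqLaw`, crux `TropicalB`, cell pub-symmetroid, seat conjb-2 g20; companion of
`KPlusLogSqLawParityAlphabetBoundary`).  For max-weight independent edge sets («matchings») of a path with `N` edges and
edge weights `A e + lam e * T` moving at integer speeds `lam e`, follow the optimum as `T` increases; a change between
consecutive optima is an *odd block* when the two sets have sizes of different parity.  The *parity law* «#odd blocks ≤ N»
is certified for speeds `{±1, ±2}` for all `N ≤ 14` (exact, kit j322292; LP-free via the hull facts of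
`KPlusLogSqLawHullFacts`).  THEORY-NOTE-g20 §2 recorded «no realisable violator for {±1,±3}, N ≤ 8 (exhaustive)» and
conjectured the law for EVERY two-speed alphabet («Conjecture 2S»).

`twoSpeed13_parityLaw_counterexample` refutes Conjecture 2S: with speeds `{±1, ±3}` and `N = 9` there is a genuine instance
whose optimum passes through ELEVEN consecutive unique optima with all TEN changes odd blocks (sizes 2,3,2,3,…,2), so
`#odd = 10 > N = 9`.  Found by the LP-free «free-part domination» filter N7 (4 survivors among 83 411 candidate chains, one
realisable) and the exact LP; verified here by `decide` on an integer instance (`a` scaled by 81; one integer sample time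
strictly inside each optimality interval; uniqueness against all `2^9` edge subsets).  Consequence for the programme: the
two-speed parity law is alphabet-dependent — `{±1, ±2}` (ratio exactly 2) is the boundary case `q = 2p` of the dividing line
`q ≤ 2p` already seen for the local Hall form.  No new definitions.
-/

namespace Summit.ValiantsHypothesis.ValiantsHypothesis.Theorems.KPlusLogSqLawTwoSpeed13Counterexample

set_option maxRecDepth 200000 in
set_option maxHeartbeats 8000000 in
/-- **Two speeds `{±1, ±3}` break the parity law at `N = 9`.**  Edges `0,…,8` of a path (edges `e`, `e+1` adjacent),
speeds `lam = (-1,-3,-1,3,-1,-3,1,3,1)`, offsets `A = (-27,-33,25,81,81,39,15,-15,-13)`, sample times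
`T = (-32,-29,-25,-21,-17,-7,3,7,11,15,18)` (breakpoints `-31,-27,-23,-19,-15,1,5,9,13,17`): at each `T k` the set `μ k`
(`{1,5}, {0,2,5}, {2,5}, {1,3,5}, {2,4}, {2,4,6}, {3,5}, {3,5,7}, {3,6}, {3,6,8}, {3,7}`) is the unique max-weight independent
edge set, and all ten consecutive changes are odd blocks (`[0,2] [0,0] [1,3] [1,5] [6,6] [2,6] [7,7] [5,7] [8,8] [6,8]`).
(conjb-2 g20; rational witness `a = (-1/3,-11/27,25/81,1,1,13/27,5/27,-5/27,-13/81)`, LP gap 4/81.) -/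
theorem twoSpeed13_parityLaw_counterexample :
    ∃ (lam A : Fin 9 → ℤ) (T : Fin 11 → ℤ) (μ : Fin 11 → Finset (Fin 9)),
      (∀ e, lam e = 1 ∨ lam e = -1 ∨ lam e = 3 ∨ lam e = -3) ∧
      StrictMono T ∧
      (∀ k, ∀ e ∈ μ k, ∀ e' ∈ μ k, e'.val ≠ e.val + 1) ∧
      (∀ k (ν : Finset (Fin 9)), (∀ e ∈ ν, ∀ e' ∈ ν, e'.val ≠ e.val + 1) → ν ≠ μ k →
          ∑ e ∈ ν, (A e + lam e * T k) < ∑ e ∈ μ k, (A e + lam e * T k)) ∧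
      9 < (Finset.univ.filter (fun k : Fin 10 => Odd ((μ k.castSucc).card + (μ k.succ).card))).card := by
  refine ⟨![-1, -3, -1, 3, -1, -3, 1, 3, 1], ![-27, -33, 25, 81, 81, 39, 15, -15, -13],
    ![-32, -29, -25, -21, -17, -7, 3, 7, 11, 15, 18],
    ![{1, 5}, {0, 2, 5}, {2, 5}, {1, 3, 5}, {2, 4}, {2, 4, 6}, {3, 5}, {3, 5, 7}, {3, 6}, {3, 6, 8}, {3, 7}],
    by decide, ?_, by decide, by decide, by decide⟩
  exact Fin.strictMono_iff_lt_succ.mpr (by decide)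

end Summit.ValiantsHypothesis.ValiantsHypothesis.Theorems.KPlusLogSqLawTwoSpeed13Counterexample
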